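/- Free-seat work of EXTRA WIDTH SEAT `ym-line-cbag-p1-w5` (prover-ym-line-cbag-p1-w5-g2-0), route `EguchiKawaiDirectionLadder`
(ideator ym-idea-2, LINE 8), crux `TripleSmallBallMargin` (stmt-QuantumFields-27724): the (a′)-DOOR — the repaired within-cluster
stub (a′) `FreeTripleSmallBall` (with `t ≤ 1`) REDUCED, kernel-checked, to the conditional triple bound `ConditionalTripleBound`
(two Haar unitaries against a fixed diagonal link, per-pair factor `triplePairFactor`) and the named fact
`WeylIntegrationFormulaUN` (Weyl's integration formula on `U(N)`, typed, unproved).  The XL content of (a′) is thereby located in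
`ConditionalTripleBound`; nothing is claimed about it here.  Nothing here bears on the Yang–Mills mass gap (barrier-ledger line). -/
import Summits.QuantumFields.YangMills.Theorems.EguchiKawaiDirectionLadderFirstLinkWeylPricing
import Summits.QuantumFields.YangMills.Theorems.EguchiKawaiDirectionLadderConditionalTripleDefs

/-!
# Route `EguchiKawaiDirectionLadder`, crux `TripleSmallBallMargin`: (a′) `FreeTripleSmallBall` from the conditional triple bound

`freeTripleSmallBall_le_one_of_conditionalTriple`:
`WeylIntegrationFormulaUN → ConditionalTripleBound → ∀ η > 0, ∃ C ≥ 0, ∃ N₀, ∀ N ≥ N₀, ∀ t ∈ (0,1],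
ekHaar 3 N {S_R ≤ t} ≤ exp(N²((3/4 − η) log t + C))` — the REPAIRED stub (a′) of the registered skeleton (the registered (a)
quantifies over all `t > 0` and is false as typed, `not_freeTripleSmallBall`).

Proof.  The event `{S_R ≤ t}` is closed and invariant under simultaneous conjugation (`ekAction_conj`), so the first-link
spectral law (`ekHaar_succ_apply_eq_weyl`, conditional on Weyl's formula) prices it as
`(N!(2π)^N)⁻¹ ∫_{[−π,π]^N} ∏_{j<k} x_jk(θ) · ekHaar 2 N {W | S_R(diag(e^{iθ}), W) ≤ t} dθ`, `x_jk = |e^{iθ_j} − e^{iθ_k}|²`.  The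
conditional triple bound bounds the fibre by `exp(N²(C − (η/2) log t)) ∏_{j<k} triplePairFactor t x_jk`, and PAIR BY PAIR
`x · triplePairFactor t x ≤ t^{3/2}` (`mul_triplePairFactor_le`), so the integrand is at most the constant
`exp(N²(C − (η/2) log t)) (t√t)^{N(N−1)/2}`; the box has volume `(2π)^N`, the prefactor `1/N! ≤ 1`, and
`(t√t)^{N(N−1)/2} t^{−(η/2)N²} ≤ t^{(3/4 − η)N²}` once `N ≥ 2/η` (`0 < t ≤ 1`).
-/

set_option autoImplicit false

noncomputable section

open MeasureTheory
open scoped ENNReal Real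
open Literature.Barriers.QuantumFields

namespace Summit.QuantumFields.YangMills.Theorems.EguchiKawaiDirectionLadder

open Literature.Probability.RandomMatrix (WeylIntegrationFormulaUN)
open Literature.MathematicalPhysics.QuantumFieldTheory (haarProbability)
open Literature.LinearAlgebra.Matrix (diagonalTorusHom)

/-! ### The per-pair factor against the Vandermonde weight -/

/-- The per-pair factor is non-negative (for a positive budget). -/
theorem triplePairFactor_nonneg {t : ℝ} (ht : 0 < t) (x : ℝ) : 0 ≤ triplePairFactor t x := by
  unfold triplePairFactor
  refine mul_nonneg (sq_nonneg _) (le_min zero_le_one ?_)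
  positivity

/-- **The Vandermonde cancels the per-pair factor**: `x · triplePairFactor t x ≤ t √t` for `0 < t ≤ 1` and every real `x`
(equality along `t ≤ x ≤ √t`, the BHN-flat range; for `x < 0` the left side is `≤ 0`). -/
theorem mul_triplePairFactor_le {t : ℝ} (ht : 0 < t) (ht1 : t ≤ 1) (x : ℝ) :
    x * triplePairFactor t x ≤ t * Real.sqrt t := by
  have hst : 0 ≤ Real.sqrt t := Real.sqrt_nonneg t
  have hsq : Real.sqrt t ^ 2 = t := Real.sq_sqrt ht.le
  have htst : t ≤ Real.sqrt t := by
    -- t ≤ √t ⟺ t² ≤ t for 0 ≤ t ≤ 1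
    have h2 : t ^ 2 ≤ t := by nlinarith
    calc t = Real.sqrt (t ^ 2) := (Real.sqrt_sq ht.le).symm
      _ ≤ Real.sqrt t := Real.sqrt_le_sqrt h2
  unfold triplePairFactor
  rcases le_or_gt x t with hxt | hxt
  · -- x ≤ t: factor = min 1 t = t
    have hsimp : t ^ 2 / t = t := by rw [sq, mul_div_assoc, div_self ht.ne', mul_one]
    rw [max_eq_right hxt, div_self ht.ne', one_pow, one_mul, hsimp, min_eq_right ht1]
    calc x * t ≤ t * t := by nlinarith
      _ ≤ t * Real.sqrt t := by nlinarith
  · -- x > t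
    have hx0 : 0 < x := ht.trans hxt
    rw [max_eq_left hxt.le]
    rcases le_or_gt (x ^ 2 / t) 1 with hx2 | hx2
    · -- x² ≤ t : factor = (t/x)² (x²/t), product x t ≤ t √t
      rw [min_eq_right hx2]
      have hxs : x ≤ Real.sqrt t := by
        rw [div_le_one ht] at hx2
        calc x = Real.sqrt (x ^ 2) := (Real.sqrt_sq hx0.le).symm
          _ ≤ Real.sqrt t := Real.sqrt_le_sqrt hx2
      have hval : x * ((t / x) ^ 2 * (x ^ 2 / t)) = x * t := by
        field_simp
      rw [hval]
      nlinarith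
    · -- x² > t : factor = (t/x)², product t²/x ≤ t √t
      rw [min_eq_left hx2.le, mul_one]
      have hxs : Real.sqrt t ≤ x := by
        rw [lt_div_iff₀ ht, one_mul] at hx2
        calc Real.sqrt t ≤ Real.sqrt (x ^ 2) := Real.sqrt_le_sqrt hx2.le
          _ = x := Real.sqrt_sq hx0.le
      have hval : x * (t / x) ^ 2 = t ^ 2 / x := by
        field_simp
      rw [hval, div_le_iff₀ hx0]
      -- t² ≤ t √t x  since √t √t = t and √t ≤ x
      nlinarith [mul_le_mul_of_nonneg_left hxs (mul_nonneg ht.le hst)]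

/-- Product form of the cancellation: `(∏_{j<k} x_jk) · (∏_{j<k} triplePairFactor t x_jk) ≤ (t√t)^{N(N−1)/2}` for non-negative
`x_jk`. -/
theorem vandermonde_mul_prod_triplePairFactor_le {N : ℕ} {t : ℝ} (ht : 0 < t) (ht1 : t ≤ 1) (x : Fin N → Fin N → ℝ)
    (hx : ∀ j k, 0 ≤ x j k) :
    (∏ j : Fin N, ∏ k ∈ Finset.Ioi j, x j k) * (∏ j : Fin N, ∏ k ∈ Finset.Ioi j, triplePairFactor t (x j k)) ≤
      (t * Real.sqrt t) ^ (N * (N - 1) / 2) := by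
  rw [← Finset.prod_mul_distrib]
  have hinner : ∀ j : Fin N, (∏ k ∈ Finset.Ioi j, x j k) * (∏ k ∈ Finset.Ioi j, triplePairFactor t (x j k)) =
      ∏ k ∈ Finset.Ioi j, (x j k * triplePairFactor t (x j k)) := fun j => (Finset.prod_mul_distrib).symm
  simp_rw [hinner]
  rw [← SpectralWindow.sum_card_Ioi_fin N, ← Finset.prod_pow_eq_pow_sum]
  refine Finset.prod_le_prod (fun j _ => Finset.prod_nonneg fun k _ =>
    mul_nonneg (hx j k) (triplePairFactor_nonneg ht _)) fun j _ => ?_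
  calc ∏ k ∈ Finset.Ioi j, x j k * triplePairFactor t (x j k)
      ≤ ∏ _k ∈ Finset.Ioi j, (t * Real.sqrt t) :=
        Finset.prod_le_prod (fun k _ => mul_nonneg (hx j k) (triplePairFactor_nonneg ht _))
          fun k _ => mul_triplePairFactor_le ht ht1 (x j k)
    _ = (t * Real.sqrt t) ^ (Finset.Ioi j).card := Finset.prod_const _

/-! ### Exponent bookkeeping -/

/-- `N(N−1)/2` as a real number. -/
theorem cast_choose_pairs (N : ℕ) : ((N * (N - 1) / 2 : ℕ) : ℝ) = ((N : ℝ) ^ 2 - N) / 2 := by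
  rcases Nat.eq_zero_or_pos N with h0 | hpos
  · subst h0; simp
  · obtain ⟨n, rfl⟩ : ∃ n, N = n + 1 := ⟨N - 1, (Nat.succ_pred_eq_of_pos hpos).symm⟩
    have heven : 2 ∣ (n + 1) * (n + 1 - 1) := by
      rw [Nat.add_sub_cancel, mul_comm]
      exact (Nat.even_mul_succ_self n).two_dvd
    rw [Nat.cast_div heven two_ne_zero]
    push_cast
    ring

/-- `(t√t)^{N(N−1)/2} = exp((3/4)(N² − N) log t)` for `t > 0`. -/
theorem pow_pairs_eq_exp {t : ℝ} (ht : 0 < t) (N : ℕ) :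
    (t * Real.sqrt t) ^ (N * (N - 1) / 2) = Real.exp ((3 / 4) * ((N : ℝ) ^ 2 - N) * Real.log t) := by
  have hts : t * Real.sqrt t = Real.exp ((3 / 2) * Real.log t) := by
    have h1 : Real.sqrt t = Real.exp (Real.log t / 2) := by
      rw [← Real.sqrt_sq (Real.exp_pos (Real.log t / 2)).le, ← Real.exp_nat_mul]
      congr 1
      rw [show ((2 : ℕ) : ℝ) * (Real.log t / 2) = Real.log t by push_cast; ring, Real.exp_log ht]
    have h2 : Real.exp ((3 / 2) * Real.log t) = Real.exp (Real.log t) * Real.exp (Real.log t / 2) := by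
      rw [← Real.exp_add]; ring_nf
    rw [h2, Real.exp_log ht, ← h1]
  rw [hts, ← Real.exp_nat_mul, cast_choose_pairs]
  congr 1; ring

/-- The final exponent comparison: for `0 < t ≤ 1`, `N ≥ 2/η`, `0 < η`,
`(1/N!) · exp(N²(C − (η/2) log t)) · (t√t)^{N(N−1)/2} ≤ exp(N²((3/4 − η) log t + C))`. -/
theorem door_exponent_le {η C t : ℝ} {N : ℕ} (hη : 0 < η) (ht : 0 < t) (ht1 : t ≤ 1) (hN : 2 / η ≤ (N : ℝ)) :
    ((N.factorial : ℝ))⁻¹ * (Real.exp ((N : ℝ) ^ 2 * (C - η / 2 * Real.log t)) *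
        (t * Real.sqrt t) ^ (N * (N - 1) / 2)) ≤
      Real.exp ((N : ℝ) ^ 2 * ((3 / 4 - η) * Real.log t + C)) := by
  have hlog : Real.log t ≤ 0 := Real.log_nonpos ht.le ht1
  have hfac : ((N.factorial : ℝ))⁻¹ ≤ 1 := by
    apply inv_le_one_of_one_le₀
    exact_mod_cast Nat.one_le_iff_ne_zero.mpr (Nat.factorial_ne_zero N)
  have hNη : (3 / 4 : ℝ) * N ≤ η / 2 * (N : ℝ) ^ 2 := by
    -- from 2/η ≤ N: η N ≥ 2, so (η/2) N² = (η N / 2) N ≥ N ≥ (3/4) N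
    have hN0 : (0 : ℝ) ≤ N := Nat.cast_nonneg N
    have hηN : 2 ≤ η * N := by
      have := (div_le_iff₀ hη).mp hN
      linarith [mul_comm (N : ℝ) η]
    nlinarith
  rw [pow_pairs_eq_exp ht, ← Real.exp_add]
  calc ((N.factorial : ℝ))⁻¹ * Real.exp ((N : ℝ) ^ 2 * (C - η / 2 * Real.log t) +
          (3 / 4) * ((N : ℝ) ^ 2 - N) * Real.log t)
      ≤ 1 * Real.exp ((N : ℝ) ^ 2 * (C - η / 2 * Real.log t) + (3 / 4) * ((N : ℝ) ^ 2 - N) * Real.log t) :=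
        mul_le_mul_of_nonneg_right hfac (Real.exp_pos _).le
    _ ≤ Real.exp ((N : ℝ) ^ 2 * ((3 / 4 - η) * Real.log t + C)) := by
        rw [one_mul, Real.exp_le_exp]
        -- difference = log t · ((η/2) N² − (3/4) N) ≤ 0
        nlinarith [mul_nonneg_of_nonpos_of_nonpos hlog (show (3 / 4 : ℝ) * N - η / 2 * (N : ℝ) ^ 2 ≤ 0 by linarith)]

/-! ### The door -/

/-- The volume of the eigenangle box `[−π, π]^N` is `(2π)^N`. -/
theorem volume_angleBox (N : ℕ) :
    volume (Set.pi Set.univ fun _ : Fin N => Set.Icc (-π) π) = ENNReal.ofReal ((2 * π) ^ N) := by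
  rw [volume_pi_pi]
  simp only [Real.volume_Icc, Finset.prod_const, Finset.card_univ, Fintype.card_fin]
  rw [show π - -π = 2 * π by ring, ENNReal.ofReal_pow (by positivity)]

/-- **(a′) from the conditional triple bound and Weyl's integration formula.**  The repaired within-cluster stub of
stmt-QuantumFields-27724 — `∀ η > 0, ∃ C ≥ 0, ∃ N₀, ∀ N ≥ N₀, ∀ t ∈ (0, 1], ekHaar 3 N {S_R ≤ t} ≤ exp(N²((3/4 − η) log t + C))` —
follows from `ConditionalTripleBound` (where the XL content now sits: two Haar unitaries against a fixed diagonal link) and the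
named fact `WeylIntegrationFormulaUN`.  Nothing is claimed about either hypothesis. -/
theorem freeTripleSmallBall_le_one_of_conditionalTriple (hW : WeylIntegrationFormulaUN) (hC : ConditionalTripleBound)
    (η : ℝ) (hη : 0 < η) :
    ∃ C : ℝ, 0 ≤ C ∧ ∃ N₀ : ℕ, ∀ N : ℕ, N₀ ≤ N → ∀ t : ℝ, 0 < t → t ≤ 1 →
      ekHaar 3 N {U : EKConfig 3 N | ekAction U ≤ t} ≤
        ENNReal.ofReal (Real.exp ((N : ℝ) ^ 2 * ((3 / 4 - η) * Real.log t + C))) := by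
  obtain ⟨C, hC0, N₀, hCTB⟩ := hC (η / 2) (half_pos hη)
  refine ⟨C, hC0, max N₀ ⌈2 / η⌉₊, fun N hN t ht ht1 => ?_⟩
  have hN₀ : N₀ ≤ N := le_trans (le_max_left _ _) hN
  have hNη : 2 / η ≤ (N : ℝ) := (Nat.le_ceil _).trans (by exact_mod_cast le_trans (le_max_right _ _) hN)
  -- the event and its symmetries
  set E : Set (EKConfig 3 N) := {U | ekAction U ≤ t} with hEdef
  have hE : MeasurableSet E := (isClosed_ekAction_le t).measurableSet
  have hconj : ∀ (V : UN N) (U : EKConfig (2 + 1) N), U ∈ E → (fun α => V * U α * V⁻¹) ∈ E := by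
    intro V U hU
    simpa only [hEdef, Set.mem_setOf_eq, ekAction_conj] using hU
  -- Weyl pricing by the eigenangles of the first link
  rw [ekHaar_succ_apply_eq_weyl (d := 2) hW hE hconj]
  set box : Set (Fin N → ℝ) := Set.pi Set.univ (fun _ : Fin N => Set.Icc (-π) π) with hbox
  set K : ℝ := Real.exp ((N : ℝ) ^ 2 * (C - η / 2 * Real.log t)) * (t * Real.sqrt t) ^ (N * (N - 1) / 2) with hK
  have hK0 : 0 ≤ K := by positivity
  -- pointwise bound of the integrand by the constant K
  have hpt : ∀ θ : Fin N → ℝ,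
      ENNReal.ofReal (∏ j : Fin N, ∏ k ∈ Finset.Ioi j,
          ‖Complex.exp (θ j * Complex.I) - Complex.exp (θ k * Complex.I)‖ ^ 2) *
        ekHaar 2 N {W : EKConfig 2 N |
          (Fin.cons (diagonalTorusHom (Fin N) fun j => Circle.exp (θ j)) W : EKConfig (2 + 1) N) ∈ E} ≤
      ENNReal.ofReal K := by
    intro θ
    have hfib := hCTB N hN₀ t ht ht1 θ
    have hset : {W : EKConfig 2 N |
        (Fin.cons (diagonalTorusHom (Fin N) fun j => Circle.exp (θ j)) W : EKConfig (2 + 1) N) ∈ E} =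
        {W : EKConfig 2 N |
          ekAction (Fin.cons (diagonalTorusHom (Fin N) fun j => Circle.exp (θ j)) W : EKConfig 3 N) ≤ t} := rfl
    rw [hset]
    set V : ℝ := ∏ j : Fin N, ∏ k ∈ Finset.Ioi j,
      ‖Complex.exp (θ j * Complex.I) - Complex.exp (θ k * Complex.I)‖ ^ 2 with hV
    have hV0 : 0 ≤ V := Finset.prod_nonneg fun j _ => Finset.prod_nonneg fun k _ => by positivity
    calc ENNReal.ofReal V * ekHaar 2 N {W : EKConfig 2 N |
            ekAction (Fin.cons (diagonalTorusHom (Fin N) fun j => Circle.exp (θ j)) W : EKConfig 3 N) ≤ t}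
        ≤ ENNReal.ofReal V * ENNReal.ofReal (Real.exp ((N : ℝ) ^ 2 * (C - η / 2 * Real.log t)) *
            ∏ j : Fin N, ∏ k ∈ Finset.Ioi j,
              triplePairFactor t (‖Complex.exp (θ j * Complex.I) - Complex.exp (θ k * Complex.I)‖ ^ 2)) :=
          mul_le_mul' le_rfl hfib
      _ = ENNReal.ofReal (Real.exp ((N : ℝ) ^ 2 * (C - η / 2 * Real.log t)) *
            (V * ∏ j : Fin N, ∏ k ∈ Finset.Ioi j,
              triplePairFactor t (‖Complex.exp (θ j * Complex.I) - Complex.exp (θ k * Complex.I)‖ ^ 2))) := by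
          rw [← ENNReal.ofReal_mul hV0]
          congr 1
          ring
      _ ≤ ENNReal.ofReal K := by
          apply ENNReal.ofReal_le_ofReal
          rw [hK]
          exact mul_le_mul_of_nonneg_left
            (vandermonde_mul_prod_triplePairFactor_le ht ht1 _ fun j k => by positivity) (Real.exp_pos _).le
  -- integrate the constant over the box and collect the prefactors
  have hint : ∫⁻ θ in box, ENNReal.ofReal (∏ j : Fin N, ∏ k ∈ Finset.Ioi j,
          ‖Complex.exp (θ j * Complex.I) - Complex.exp (θ k * Complex.I)‖ ^ 2) *
        ekHaar 2 N {W : EKConfig 2 N |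
          (Fin.cons (diagonalTorusHom (Fin N) fun j => Circle.exp (θ j)) W : EKConfig (2 + 1) N) ∈ E} ≤
      ENNReal.ofReal K * ENNReal.ofReal ((2 * π) ^ N) := by
    calc ∫⁻ θ in box, ENNReal.ofReal (∏ j : Fin N, ∏ k ∈ Finset.Ioi j,
            ‖Complex.exp (θ j * Complex.I) - Complex.exp (θ k * Complex.I)‖ ^ 2) *
          ekHaar 2 N {W : EKConfig 2 N |
            (Fin.cons (diagonalTorusHom (Fin N) fun j => Circle.exp (θ j)) W : EKConfig (2 + 1) N) ∈ E}
        ≤ ∫⁻ _θ in box, ENNReal.ofReal K := lintegral_mono fun θ => hpt θ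
      _ = ENNReal.ofReal K * volume box := setLIntegral_const box _
      _ = ENNReal.ofReal K * ENNReal.ofReal ((2 * π) ^ N) := by rw [hbox, volume_angleBox]
  calc ENNReal.ofReal (((2 * π) ^ N * (N.factorial : ℝ))⁻¹) *
        ∫⁻ θ in box, ENNReal.ofReal (∏ j : Fin N, ∏ k ∈ Finset.Ioi j,
            ‖Complex.exp (θ j * Complex.I) - Complex.exp (θ k * Complex.I)‖ ^ 2) *
          ekHaar 2 N {W : EKConfig 2 N |
            (Fin.cons (diagonalTorusHom (Fin N) fun j => Circle.exp (θ j)) W : EKConfig (2 + 1) N) ∈ E}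
      ≤ ENNReal.ofReal (((2 * π) ^ N * (N.factorial : ℝ))⁻¹) * (ENNReal.ofReal K * ENNReal.ofReal ((2 * π) ^ N)) :=
        mul_le_mul' le_rfl hint
    _ = ENNReal.ofReal (((N.factorial : ℝ))⁻¹ * K) := by
        rw [← ENNReal.ofReal_mul hK0, ← ENNReal.ofReal_mul (by positivity)]
        congr 1
        have hπ : (2 * π) ^ N ≠ 0 := pow_ne_zero _ (by positivity)
        field_simp
    _ ≤ ENNReal.ofReal (Real.exp ((N : ℝ) ^ 2 * ((3 / 4 - η) * Real.log t + C))) :=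
        ENNReal.ofReal_le_ofReal (by rw [hK]; exact door_exponent_le hη ht ht1 hNη)

end Summit.QuantumFields.YangMills.Theorems.EguchiKawaiDirectionLadder

end
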